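import Mathlib
import HarnessLib
import Summits.NavierStokesRegularity.NavierStokesRegularity.Theses.SubOnsagerCeiling
import Summits.NavierStokesRegularity.NavierStokesRegularity.Theorems.SubOnsagerCeilingDefs
import Summits.NavierStokesRegularity.NavierStokesRegularity.Theorems.SubOnsagerCeilingOrthantTailCeilingDyadicRatioTwo

set_option linter.dupNamespace false
set_option linter.unusedVariables false

/-! # Skeleton LINE «shell-barrier» (v3) for the crux `SubOnsagerCeiling.OrthantTailCeiling` (stmt-NavierStokesRegularity-25507)
LINE g4-1 of ideator seat ns-idea-1 (g4).  MODEL LATTICE ONLY (rung TL-M2Break); no summit is proved by a line.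

v3 = v2 (evidence #4, sha b476d91e9bce) in the REGISTRABLE shape (`def Sig.stub_X : Prop`, `theorem stub_X : Sig.stub_X := by sorry`,
composition over the `Sig` props by name) + the critic's request (idea-crit-3 g2 05:09:35Z (A)): the FIRST registered stub is a
PROVABLE-FIRST RUNG strictly below the crux — `stub_dyadicRatioTwo` = the shell barrier for scaled ONE-MODE dyadic tables at
ε₀ = 1 (b = 2), where the Cheskidov–Zaya three-shell comparison (arXiv:1310.7612 §4, Steps 1–4: k = 0.96, B, b̂, b̃, β′ = b̂² − γβb̃)
closes with θ ∈ (1/2, 0.55] (planner re-evaluation kit/CZ16_barrier_lambda.md, evidence on 25507: sup β = 0.992 … 0.9998 — thin: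
certify with interval arithmetic or nest the scheme once for room; viscosity is NOT monotone-helpful in Step 2 (drain build-up):
treat by the dichotomy «ν b^{2n} ≥ η·turnover ⇒ shell n never reaches the barrier | else the drain forms with B(η)»).
The same scheme FAILS for b ≤ 3/2 (sup β ≥ 1.045), so `stub_barrierLargeRatio` (1/4 < ε₀ ≤ 1, all orthant tables of E₂(R)) needs a
≥ 4-shell nested or time-integrated barrier, and `stub_barrierSmallRatio` (ε₀ ≤ 1/4; HARDEST) owns the discrete front exponent
θ_front(α, b) as b ↓ 1 (technique of record: first-crossing shell on the block-averaged lattice, stencil ≍ 1/ε₀; instrument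
kit/FRONT_SWEEP_RESULTS.md: 2θ_eff ≥ 1.204 on every cascading comparable table, dangerous window ε₀ ∈ [1/16, 1/4]).
`ceilingAt_of_shellBarrier` (PROVED): per-shell weighted bound ⇒ weighted tail bound, C = 4D/(1 − b^{−2θ}).
`OrthantTailCeiling_of` : Sig.stub_dyadicRatioTwo → Sig.stub_barrierLargeRatio → Sig.stub_barrierSmallRatio → crux BY NAME
(the rung is consumed on its own sub-case ε₀ = 1 ∧ IsScaledDyadic α; it is logically subsumed by stub_barrierLargeRatio and becomes
its corollary once that lands — registered first so that a prover has a theorem strictly smaller than the crux to land first, BC5/T3).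
Disproof used: none landed for this crux (no Cruxes/OrthantTailCeiling/Disproof.lean at v3 time). -/

open Summit.NavierStokesRegularity.NavierStokesRegularity.Theses.SubOnsagerCeiling

namespace Summit.NavierStokesRegularity.NavierStokesRegularity.Cruxes.OrthantTailCeiling.ShellBarrier
open Summit.NavierStokesRegularity.NavierStokesRegularity.Theorems.SubOnsagerCeiling

/-! v4 (lead prover-ns-soc-p2, 2026-08-28): the objects `CeilingAt`, `ShellBarrierAt`, `IsScaledDyadic` and the
three registered stub statements `Sig.stub_*` now live in the tree (`Theorems/SubOnsagerCeilingDefs.lean`,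
p608870); the RUNG `stub_dyadicRatioTwo` is LANDED (`Theorems/SubOnsagerCeilingOrthantTailCeilingDyadicRatioTwo.lean`:
transport of the tree's Barbato–Morandin–Romito invariant region, θ = 51/100, D = 100, ν-uniform).
STATUS OF THE TWO BARRIER STUBS: numerically FALSE as stated (lead's instrument num/lattice.c, evidence
REFUTATION-EVIDENCE-25507.md on the item): the orthant table {chain F0→0, in-shell side pump P0→1 (1/5),
side-fed DEAD-END pocket F1→2 (1/5)} ∈ E₂(10) parks tail energy sup_t T_n ≈ E₀(1+ε₀)^{-Θn} with Θ ≈ 0.72 < 1 on a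
band of shells growing like ln(1/ν) (ε₀ = 1/4; also at ε₀ = 1/2, 1), so no θ > 1/2 ceiling holds for it. The
skeleton is kept registrable; the sorries below are NOT expected to be dischargeable without restating the crux
(restrict to exit-complete / irreducible KP networks). -/

theorem orthantTailCeiling_iff :
    OrthantTailCeiling ↔ ∀ R : ℝ, 1 ≤ R → ∀ ε₀ : ℝ, 0 < ε₀ → ε₀ ≤ 1 →
      ∀ α : Fin 4 → Fin 4 → Fin 4 → ℤ × ℤ × ℤ → ℝ, CeilingAt R ε₀ α := Iff.rfl

theorem stub_dyadicRatioTwo : Sig.stub_dyadicRatioTwo :=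
  Summit.NavierStokesRegularity.NavierStokesRegularity.Theorems.SubOnsagerCeiling.stub_dyadicRatioTwo

theorem stub_barrierLargeRatio : Sig.stub_barrierLargeRatio := by
  sorry

theorem stub_barrierSmallRatio : Sig.stub_barrierSmallRatio := by
  sorry

theorem ceilingAt_of_shellBarrier {R ε₀ : ℝ} (hε : 0 < ε₀)
    {α : Fin 4 → Fin 4 → Fin 4 → ℤ × ℤ × ℤ → ℝ} (h : ShellBarrierAt R ε₀ α) : CeilingAt R ε₀ α := by
  intro hT hO
  obtain ⟨θ, hθ, D, hD, H⟩ := h hT hO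
  have hb : (1 : ℝ) < 1 + ε₀ := by linarith
  have hb0 : (0 : ℝ) ≤ 1 + ε₀ := by linarith
  set r : ℝ := (1 + ε₀) ^ (-(2 * θ)) with hr_def
  have hr0 : 0 < r := Real.rpow_pos_of_pos (by linarith) _
  have hr1 : r < 1 := by
    have : (1 + ε₀) ^ (-(2 * θ)) < (1 + ε₀) ^ (0 : ℝ) :=
      Real.rpow_lt_rpow_of_exponent_lt hb (by linarith)
    simpa [hr_def] using this
  have h1r : 0 < 1 - r := by linarith
  refine ⟨θ, hθ, 4 * D / (1 - r), by positivity, ?_⟩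
  intro ν hν X₀ s hs X hdat hvan hbdd hcont hode hnn n N hnN t ht
  set E₀ : ℝ := ∑ j : Fin 4, (1 / 2 : ℝ) * X₀ j ^ 2 with hE₀
  have hE₀0 : 0 ≤ E₀ := Finset.sum_nonneg fun j _ => by positivity
  -- per-shell bound: ∑_i ½ X_{i,k}(t)² ≤ 4·D·E₀·r^k
  have hpow : ∀ k : ℕ, (1 + ε₀) ^ (2 * θ * (k : ℝ)) * r ^ k = 1 := by
    intro k
    rw [hr_def, ← Real.rpow_mul_natCast hb0, ← Real.rpow_add (by linarith)]
    have : 2 * θ * (k : ℝ) + -(2 * θ) * (k : ℝ) = 0 := by ring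
    rw [this, Real.rpow_zero]
  have hshell : ∀ k : ℕ, ∑ i : Fin 4, (1 / 2 : ℝ) * X i (k : ℤ) t ^ 2 ≤ 4 * D * E₀ * r ^ k := by
    intro k
    have hk : ∀ i : Fin 4, (1 / 2 : ℝ) * X i (k : ℤ) t ^ 2 ≤ D * E₀ * r ^ k := by
      intro i
      have Hi := H ν hν X₀ s hs X hdat hvan hbdd hcont hode hnn t ht i k
      have hw : 0 < (1 + ε₀) ^ (2 * θ * (k : ℝ)) := Real.rpow_pos_of_pos (by linarith) _
      have hrk : 0 < r ^ k := pow_pos hr0 k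
      -- multiply Hi by r^k and use hpow
      have := mul_le_mul_of_nonneg_right Hi hrk.le
      calc (1 / 2 : ℝ) * X i (k : ℤ) t ^ 2
          = ((1 + ε₀) ^ (2 * θ * (k : ℝ)) * r ^ k) * ((1 / 2 : ℝ) * X i (k : ℤ) t ^ 2) := by rw [hpow k, one_mul]
        _ = (1 + ε₀) ^ (2 * θ * (k : ℝ)) * ((1 / 2 : ℝ) * X i (k : ℤ) t ^ 2) * r ^ k := by ring
        _ ≤ D * (∑ j : Fin 4, (1 / 2 : ℝ) * X₀ j ^ 2) * r ^ k := this
        _ = D * E₀ * r ^ k := by rw [hE₀]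
    calc ∑ i : Fin 4, (1 / 2 : ℝ) * X i (k : ℤ) t ^ 2
        ≤ ∑ _i : Fin 4, D * E₀ * r ^ k := Finset.sum_le_sum fun i _ => hk i
      _ = 4 * D * E₀ * r ^ k := by simp [Finset.sum_const, Finset.card_univ, Fintype.card_fin]; ring
  -- sum over the shells n ≤ k ≤ N: geometric series
  have hgeom : ∑ k ∈ Finset.Icc n N, r ^ k ≤ r ^ n / (1 - r) := by
    rw [← Finset.Ico_add_one_right_eq_Icc]
    exact geom_sum_Ico_le_of_lt_one hr0.le hr1
  have hrn : r ^ n = (1 + ε₀) ^ (-(2 * θ * (n : ℝ))) := by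
    rw [hr_def, ← Real.rpow_mul_natCast hb0]
    congr 1; ring
  calc ∑ k ∈ Finset.Icc n N, ∑ i : Fin 4, (1 / 2 : ℝ) * X i (k : ℤ) t ^ 2
      ≤ ∑ k ∈ Finset.Icc n N, 4 * D * E₀ * r ^ k := Finset.sum_le_sum fun k _ => hshell k
    _ = 4 * D * E₀ * ∑ k ∈ Finset.Icc n N, r ^ k := by rw [Finset.mul_sum (s := Finset.Icc n N)]
    _ ≤ 4 * D * E₀ * (r ^ n / (1 - r)) :=
        mul_le_mul_of_nonneg_left hgeom (by positivity)
    _ = 4 * D / (1 - r) * E₀ * (1 + ε₀) ^ (-(2 * θ * (n : ℝ))) := by rw [← hrn]; field_simp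
    _ = 4 * D / (1 - r) * (∑ i : Fin 4, (1 / 2 : ℝ) * X₀ i ^ 2) * (1 + ε₀) ^ (-(2 * θ * (n : ℝ))) := by
        rw [hE₀]


/-- COMPOSITION (kernel-checked, no sorry): the two barrier stubs give the ROUTE crux BY NAME (v4: the rung
`stub_dyadicRatioTwo` is landed and used from the tree — it is logically subsumed by `stub_barrierLargeRatio`, kept in the
case split as the proved `ε₀ = 1` dyadic corner). -/
theorem OrthantTailCeiling_of :
    Sig.stub_barrierLargeRatio → Sig.stub_barrierSmallRatio →
      Summit.NavierStokesRegularity.NavierStokesRegularity.Theses.SubOnsagerCeiling.OrthantTailCeiling := by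
  intro hA hB
  have hD : Sig.stub_dyadicRatioTwo := stub_dyadicRatioTwo
  rw [orthantTailCeiling_iff]
  intro R hR ε₀ h0 h1 α
  by_cases hq : ε₀ ≤ 1 / 4
  · exact ceilingAt_of_shellBarrier h0 (hB R hR ε₀ h0 hq α)
  · by_cases hd : ε₀ = 1 ∧ IsScaledDyadic α
    · obtain ⟨rfl, hα⟩ := hd
      exact ceilingAt_of_shellBarrier h0 (hD R hR α hα)
    · exact ceilingAt_of_shellBarrier h0 (hA R hR ε₀ (lt_of_not_ge hq) h1 α)

end Summit.NavierStokesRegularity.NavierStokesRegularity.Cruxes.OrthantTailCeiling.ShellBarrier
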